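import Summits.BirchSwinnertonDyer.Rank1Residual.AdditivePotMult.PotMultCongruentPairGVBudget
import Summits.BirchSwinnertonDyer.Rank1Residual.AdditivePotMult.PotMultCongruentPartnerEPW
import Summits.BirchSwinnertonDyer.Rank1Residual.AdditivePotMult.MixedCongruentPartnerEPW
import Summits.BirchSwinnertonDyer.Rank1Residual.AdditivePotMult.PotMultWuthrichFirstUnitIndexClass
import Summits.BirchSwinnertonDyer.Rank1Residual.Additive.CongruentPartnerMainConjectureX3Gord
import HarnessLib

/-!
# Route-G budgets on the (M) rows from a GV congruent partner whose input comes from its RANK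
# alone — on X3♯ partners (`ρ̄` REDUCIBLE) with NO certificate: torsion from Wuthrich's half,
# `μ = 0` transferred from the receiver (cell `b2b-bsdres`, team n1011, seat p07 (gen 6); OWNERS
# row T-E3d-GV FILE 2; sequel of `PotMultCongruentPairGVBudget.lean`)

HONEST FRAMING (cell `b2b-bsdres`, run/shared/lean/b2b/bsd-rank1-residual/, verbatim in every
file): the goal of the cell is to DELETE the COMBINATION-SHAPED residual classes of the
Birch–Swinnerton-Dyer formula for ALL analytic-rank `≤ 1` elliptic curves over `ℚ` — "full BSD
formula for every rank `≤ 1` curve in class `C`" assembled STRICTLY from published theorems — so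
that the rank-`≤ 1` remainder becomes exactly the CONSTRUCTION-SHAPED classes, which are TYPED
(missing-input `Prop`s), NOT attempted. This is not "finishing BSD". Team n1011 (N10/N11, (M) rows =
X4(M) / X3♯(M), every odd `p` incl. `3`): research route; labels and marks UNCHANGED; nothing booked.
Consumer theorems only; NO definition; NO Literature fact; named facts as HYPOTHESES: `hGV` (GV §2
composed record), `hGrK` (A239, (G-ord) partner only), A40/A41 (`hT40`/`hT41`), `hK` (Kato 2004
Thm. 17.4 (3) half-eigenspace reading, X4 partners), `hW16` (Wuthrich 2014 Thm. 16, X3♯ partners),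
`hmodD` (modular parametrisation). Debt 0.

## What

FILE 1 (`PotMultCongruentPairGVBudget`) gives `BudgetLeLambdaAt p W b` on an (M) row from a GV
congruent partner `W₁` whose finitely generated cyclotomic dual data are torsion with
`μ = 0 ⟹ r₁ ≤ λ` (weak currency). Here that partner input is produced from the partner's RANK:

* §1 `ClassX3M.isTorsion_and_le_lambdaInvariant_of_wuthrichHalf`,
  `ClassX3Gord.isTorsion_and_le_lambdaInvariant_of_wuthrichHalf` — an X3♯(M) / X3♯(G-ord) ∩ `I₀*`
  curve `E₁` with `r₁ ≤ rank E₁(ℚ)`: every finitely generated cyclotomic dual datum of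
  `Sel_{p^∞}(E₁/ℚ_∞)` is TORSION (full-series bricks `isTorsion_and_exists_iota_eq_of_wuthrichHalf` /
  `isTorsion_and_exists_iota_eq_branch_of_wuthrichComponent` on the multiplicative / good-ordinary
  `p*`-twist model — Wuthrich's half needs NO image hypothesis and NO certificate) and
  `μ(X₁) = 0 ⟹ r₁ ≤ λ(X₁)` (Greenberg–Vatsal (1) ⟺ (2) + `T^{rank} ∣ char`, n1011-p10's
  `le_lambdaInvariant_of_le_mordellWeilRank`). On reducible rows `μ = 0` is NOT automatic, and it is
  NOT claimed: it is the premise. (X4 twins: p07-g3 `ClassX4M.isTorsion_and_le_lambdaInvariant_of_katoHalf`,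
  g5 `ClassX4Gord.isTorsion_and_le_lambdaInvariant_of_katoHalf`.)
* §2 the fully composed budgets `ClassX4M.budgetLeLambdaAt_of_gv_of_{mult,gord}Partner_of_rank` and
  `ClassX3M.budgetLeLambdaAt_of_gv_of_{mult,gord}Partner_of_rank`: per pair the residual inputs are
  EXACTLY `TorsionIso W W₁ p` (certificate), `Σ₀`, `r₁ ≤ rank E₁(ℚ)` (+ `ρ̄_{E₁,p}` onto on X4, + ONE
  census bit `p ∤ #E(ℚ)_tors` on X3), and `b ≤ r₁ + Σ_{w∈Σ₀} (δ(E₁,w) − δ(E,w))`.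

What is NOT claimed: the (G-ord)-row twins; `μ = 0` on any reducible curve; semistable or
`e ∈ {3,4,6}` partners; `p = 2`. X3♯(M) / X4(M) stay CONSTRUCTION-SHAPED; nothing booked.

References: R. Greenberg, V. Vatsal, Invent. Math. 142 (2000) §2, p. 2 (1)–(2)
[GreenbergVatsal2000]; C. Wuthrich, J. London Math. Soc. 89 (2014) Thm. 16 [Wuthrich2014]; K. Kato,
Astérisque 295 (2004) Thm. 17.4 (3) [Kato2004Asterisque]; R. Greenberg, LNM 1716 (1999) §3 Lemma
3.1, Prop. 4.14 [GreenbergLNM1716]; J. H. Silverman, *ATAEC* V.5.3, Cor. V.5.4 [SilvermanATAEC1994].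
-/

set_option autoImplicit false

noncomputable section

open scoped Classical MatrixGroups ModularForm NumberField

open CongruenceSubgroup WeierstrassCurve NumberField IsDedekindDomain Field
  Literature.NumberTheory.EllipticCurves
  Literature.NumberTheory.EllipticCurves.ModularForms
  Literature.NumberTheory.EllipticCurves.Rank1Residual
  Literature.NumberTheory.EllipticCurves.Rank1Residual.Typed
  Literature.NumberTheory.EllipticCurves.GreenbergSelmer
  Literature.NumberTheory.EllipticCurves.Greenberg1999
  Literature.NumberTheory.EllipticCurves.Wuthrich2014
  Literature.NumberTheory.EllipticCurves.GreenbergVatsal2000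
  Literature.NumberTheory.GaloisRepresentations
  Summit.BirchSwinnertonDyer.Rank1Residual.X1.MuLambda
  Summit.BirchSwinnertonDyer.Rank1Residual.X11a
  Summit.BirchSwinnertonDyer.Rank1Residual.Iwasawa

open Summit.BirchSwinnertonDyer.Rank1Residual.X1.CongruenceTransfer (TorsionIso CongruentLambdaShift)

/-! ### §1 X3♯ partners: torsion and `μ = 0 ⟹ r₁ ≤ λ` from Wuthrich's half and the RANK — no certificate -/

namespace Summit.BirchSwinnertonDyer.Rank1Residual.AdditivePotMult

open Summit.BirchSwinnertonDyer.Rank1Residual.Additive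

section PartnerX3M

variable {W₁ : WeierstrassCurve ℚ} [W₁.IsElliptic] [W₁.IsGloballyMinimal] {p : ℕ} [hp : Fact p.Prime]

/-- **X3♯(M) partner, EVERY odd `p` (`p = 3` included): torsion and `μ = 0 ⟹ r₁ ≤ λ` with NO
certificate and NO image hypothesis.** For `W₁` X3♯(M) (`ρ̄_{E₁,p}` reducible, additive potentially
multiplicative at `p`), the modular parametrisation (`hmodD`) and Wuthrich's divisibility (`hW16`):
every finitely generated cyclotomic dual datum `D₁` of `Sel_{p^∞}(E₁/ℚ_∞)` is TORSION (the full-series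
brick `isTorsion_and_exists_iota_eq_of_wuthrichHalf` on the multiplicative `p*`-twist model, either
sign of `a_p(E₁♭)`), and `μ(X₁) = 0 ⟹ r₁ ≤ λ(X₁)` for every `r₁ ≤ rank E₁(ℚ)` (a generator of unit
content by Greenberg–Vatsal (1) ⟺ (2), then `T^{rank} ∣ char`, n1011-p10's
`le_lambdaInvariant_of_le_mordellWeilRank`). The X3♯(M) twin of p07-g3's
`ClassX4M.isTorsion_and_le_lambdaInvariant_of_katoHalf`; exactly the partner hypothesis `h₁` of
FILE 1. [cite: Wuthrich2014, Thm. 16 (p. 397)] [cite: GreenbergVatsal2000, p. 2, (1)–(2)]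
[cite: GreenbergLNM1716, §3 Lemma 3.1 (T^{rank} ∣ char)] [cite: SilvermanATAEC1994, Ch. V Thm. 5.3] -/
theorem ClassX3M.isTorsion_and_le_lambdaInvariant_of_wuthrichHalf
    (hW16 : Wuthrich2014.thm16_halfEigenCharIdeal_dvd_cyclotomicPrime)
    (hmodD : nonempty_modularParametrizationData)
    (hX₁ : ClassX3M W₁ p) {r₁ : ℕ} (hr₁ : r₁ ≤ W₁.mordellWeilRank)
    {κ : ZpExtension ℚ p} {γ : absoluteGaloisGroup ℚ}
    (hκ : κ.IsCyclotomic) (hγ : κ.IsTopGenerator γ) (hγ' : IsCyclotomicVariable p γ)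
    (D₁ : W₁.SelmerDualData κ γ) [Module.Finite (IwasawaAlgebra p) D₁.X] :
    D₁.IsTorsion ∧ (D₁.mu = 0 → r₁ ≤ lambdaInvariant p D₁.X) := by
  have hp2 : p ≠ 2 := hX₁.p_ne_two
  obtain ⟨V, iV, iVm, C, hV, hC⟩ := hX₁.exists_mult_pStar_twist_model
  haveI : NeZero (V.conductorNorm ℤ) := ⟨(V.conductorNorm_pos_holds).ne'⟩
  obtain ⟨Dm⟩ := hmodD V
  obtain ⟨ϖ, hϖ⟩ := exists_periodRatio_parity (p := p) V Dm
  have hirrV : ¬ V.HasIrreducibleModPGaloisRep p := fun hVirr ↦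
    hX₁.classX3.1 ((irr_iff_of_model_twist (W := V) (p := p) (pStar_ne_zero p) ⟨C, hC⟩).mpr hVirr)
  -- torsion from the brick, on the split / non-split multiplicative branch series of `E₁♭`
  have hXt : D₁.IsTorsion := by
    by_cases hs : V.HasSplitMultiplicativeReductionAtPrime p
    · exact (isTorsion_and_exists_iota_eq_of_wuthrichHalf hW16 hp2 V C hC hirrV hκ hγ hγ'
        Dm.isNewformOf D₁ _ (Or.inr (Or.inl ⟨hs, rfl⟩)) ϖ hϖ).1
    · exact (isTorsion_and_exists_iota_eq_of_wuthrichHalf hW16 hp2 V C hC hirrV hκ hγ hγ'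
        Dm.isNewformOf D₁ _ (Or.inr (Or.inr ⟨hV, hs, rfl⟩)) ϖ hϖ).1
  refine ⟨hXt, fun hmu ↦ ?_⟩
  obtain ⟨fE₁, hchar, -⟩ := exists_charIdeal_eq_span_singleton p D₁
  have hfE : HasUnitContent fE₁ :=
    (GreenbergVatsal2000.mu_eq_zero_iff_hasUnitContent D₁ hXt hchar).mp hmu
  exact le_lambdaInvariant_of_le_mordellWeilRank hγ D₁ hXt hchar hfE (dvd_refl fE₁) hr₁

end PartnerX3M

end Summit.BirchSwinnertonDyer.Rank1Residual.AdditivePotMult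

namespace Summit.BirchSwinnertonDyer.Rank1Residual.Additive

open Summit.BirchSwinnertonDyer.Rank1Residual.AdditivePotMult

section PartnerX3Gord

variable {W₁ : WeierstrassCurve ℚ} [W₁.IsElliptic] [W₁.IsGloballyMinimal] {p : ℕ} [hp : Fact p.Prime]

/-- **X3♯(G-ord) ∩ `I₀*` partner, EVERY odd `p`: torsion and `μ = 0 ⟹ r₁ ≤ λ` with NO certificate
and NO image hypothesis.** For `W₁` X3♯(G-ord) with `semistabilityIndex W₁ p = 2`, `hmodD` and `hW16`:
every finitely generated cyclotomic dual datum `D₁` of `Sel_{p^∞}(E₁/ℚ_∞)` is TORSION (the full-series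
brick `isTorsion_and_exists_iota_eq_branch_of_wuthrichComponent` on the good-ordinary `p*`-twist model
`ClassX3Gord.exists_goodOrd_pStar_twist_model`), and `μ(X₁) = 0 ⟹ r₁ ≤ λ(X₁)` for every
`r₁ ≤ rank E₁(ℚ)`. The X3♯(G-ord) twin of g5's `ClassX4Gord.isTorsion_and_le_lambdaInvariant_of_katoHalf`.
[cite: Wuthrich2014, Thm. 16 (p. 397)] [cite: GreenbergVatsal2000, p. 2, (1)–(2)]
[cite: GreenbergLNM1716, §3 Lemma 3.1 (T^{rank} ∣ char)] -/
theorem ClassX3Gord.isTorsion_and_le_lambdaInvariant_of_wuthrichHalf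
    (hW16 : Wuthrich2014.thm16_halfEigenCharIdeal_dvd_cyclotomicPrime)
    (hmodD : nonempty_modularParametrizationData)
    (hp2 : p ≠ 2) (hX₁ : ClassX3Gord W₁ p) (he₁ : semistabilityIndex W₁ p = 2) {r₁ : ℕ}
    (hr₁ : r₁ ≤ W₁.mordellWeilRank)
    {κ : ZpExtension ℚ p} {γ : absoluteGaloisGroup ℚ}
    (hκ : κ.IsCyclotomic) (hγ : κ.IsTopGenerator γ) (hγ' : IsCyclotomicVariable p γ)
    (D₁ : W₁.SelmerDualData κ γ) [Module.Finite (IwasawaAlgebra p) D₁.X] :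
    D₁.IsTorsion ∧ (D₁.mu = 0 → r₁ ≤ lambdaInvariant p D₁.X) := by
  obtain ⟨V, iV, iVm, C, hV, hC⟩ := ClassX3Gord.exists_goodOrd_pStar_twist_model W₁ p hp2 hX₁ he₁
  haveI : NeZero (V.conductorNorm ℤ) := ⟨(V.conductorNorm_pos_holds).ne'⟩
  obtain ⟨Dm⟩ := hmodD V
  obtain ⟨ϖ, hϖ⟩ := exists_periodRatio_parity (p := p) V Dm
  -- torsion from Wuthrich's half on the good-ordinary branch (full-series brick)
  obtain ⟨hXt, -⟩ := isTorsion_and_exists_iota_eq_branch_of_wuthrichComponent W₁ p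
    (Wuthrich2014.charIdeal_dvd_padicLFunctionBranch_component_of_half hW16)
    (padicValRat_j_nonneg_of_typeGOrd W₁ p hX₁.typeGOrd) hp2 V ⟨C, hC⟩ (Or.inl hV) hX₁.classX3.1
    hκ hγ hγ' Dm.isNewformOf D₁ ϖ hϖ
  refine ⟨hXt, fun hmu ↦ ?_⟩
  obtain ⟨fE₁, hchar, -⟩ := exists_charIdeal_eq_span_singleton p D₁
  have hfE : HasUnitContent fE₁ :=
    (GreenbergVatsal2000.mu_eq_zero_iff_hasUnitContent D₁ hXt hchar).mp hmu
  exact le_lambdaInvariant_of_le_mordellWeilRank hγ D₁ hXt hchar hfE (dvd_refl fE₁) hr₁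

end PartnerX3Gord

end Summit.BirchSwinnertonDyer.Rank1Residual.Additive

/-! ### §2 The fully composed budgets: partner of enough RANK, nothing else at the partner -/

namespace Summit.BirchSwinnertonDyer.Rank1Residual.AdditivePotMult

open Summit.BirchSwinnertonDyer.Rank1Residual.Additive

section Composed

variable {W W₁ : WeierstrassCurve ℚ} [W.IsElliptic] [W.IsGloballyMinimal] [W₁.IsElliptic]
  [W₁.IsGloballyMinimal] {p : ℕ} [hp : Fact p.Prime]

/-- **X4(M) row, X4(M) ∧ surj(p) partner of rank `≥ r₁`: the EPW-free Route-G budget** —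
`BudgetLeLambdaAt p W b` for every `b ≤ r₁ + Σ_{w∈Σ₀} (δ(E₁,w) − δ(E,w))` from `hGV`, `hK`, `hmodD`,
A40/A41, a `TorsionIso` certificate, `Σ₀`, `ρ̄_{E₁,p}` onto and `r₁ ≤ rank E₁(ℚ)` (FILE 1 +
p07-g3's `ClassX4M.isTorsion_and_le_lambdaInvariant_of_katoHalf`). The EPW-free twin of g4's
`ClassX4M.budgetLeLambdaAt_of_epw_of_multPartner_of_congr`. PER PAIR; nothing booked.
[cite: GreenbergVatsal2000, §2 Prop. (2.8) with Remark (2.9), Cor. (2.3), Prop. (2.4), pp. 26–27 (arXiv:math/9906215)]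
[cite: Kato2004Asterisque, Thm. 17.4 (3) (p. 273)] [cite: SilvermanATAEC1994, Ch. V Thm. 5.3, Cor. 5.4] -/
theorem ClassX4M.budgetLeLambdaAt_of_gv_of_multPartner_of_rank
    (hGV : muLambdaAlg_transfer_of_torsionIso_potOrd_of_not_dvd_torsionOrder)
    (hK : Wuthrich2014.kato_halfEigenCharIdeal_dvd_cyclotomicPrime_of_surjective)
    (hmodD : nonempty_modularParametrizationData)
    (hT40 : Silverman1994_thmV53_tateUniformisation.{0})
    (hT41 : Silverman1994_thmV53_corV54_tateUniformisation.{0})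
    (hX : ClassX4M W p) (hX₁ : ClassX4M W₁ p) (hsurj₁ : Surj W₁ p) {r₁ : ℕ}
    (hr₁ : r₁ ≤ W₁.mordellWeilRank) (hT : TorsionIso W W₁ p)
    (S₀ : Finset (HeightOneSpectrum (𝓞 ℚ))) (hS₀ : ∀ w ∈ S₀, ((p : ℕ) : 𝓞 ℚ) ∉ w.asIdeal)
    (hS : ∀ w : HeightOneSpectrum (𝓞 ℚ), w ∉ S₀ → ((p : ℕ) : 𝓞 ℚ) ∉ w.asIdeal →
      W.HasGoodReductionAt w)
    (hS₁ : ∀ w : HeightOneSpectrum (𝓞 ℚ), w ∉ S₀ → ((p : ℕ) : 𝓞 ℚ) ∉ w.asIdeal →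
      W₁.HasGoodReductionAt w)
    {b : ℕ} (hb : (b : ℤ) ≤ r₁ + ∑ w ∈ S₀, ((delta W₁ p w : ℤ) - (delta W p w : ℤ))) :
    BudgetLeLambdaAt p W b :=
  hX.budgetLeLambdaAt_of_gv_of_multPartner_of_congr hGV hT40 hT41 hX₁ hT S₀ hS₀ hS hS₁
    (fun hκ hγ hγ' D₁ _ ↦
      hX₁.isTorsion_and_le_lambdaInvariant_of_katoHalf hK hmodD hsurj₁ hr₁ hκ hγ hγ' D₁) hb

/-- **X4(M) row, X4♯(G-ord) ∩ `I₀*` ∧ surj(p) partner of rank `≥ r₁`: the EPW-free Route-G budget**,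
mod A40/A41 | `hGrK` (FILE 1 + g5's `ClassX4Gord.isTorsion_and_le_lambdaInvariant_of_katoHalf`). The
EPW-free twin of g5's `ClassX4M.budgetLeLambdaAt_of_epw_of_gordPartner_of_congr`. PER PAIR; nothing booked.
[cite: GreenbergVatsal2000, §2 Prop. (2.8) with Remark (2.9), Cor. (2.3), Prop. (2.4), pp. 26–27 (arXiv:math/9906215)]
[cite: Kato2004Asterisque, Thm. 17.4 (3) (p. 273)] [cite: GreenbergLNM1716, §2 Props. 2.2, 2.4 (pp. 73–75)] -/
theorem ClassX4M.budgetLeLambdaAt_of_gv_of_gordPartner_of_rank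
    (hGV : muLambdaAlg_transfer_of_torsionIso_potOrd_of_not_dvd_torsionOrder)
    (hGrK : imKummer_ge_strictCondition_goodOrdinary)
    (hK : Wuthrich2014.kato_halfEigenCharIdeal_dvd_cyclotomicPrime_of_surjective)
    (hmodD : nonempty_modularParametrizationData)
    (hT40 : Silverman1994_thmV53_tateUniformisation.{0})
    (hT41 : Silverman1994_thmV53_corV54_tateUniformisation.{0})
    (hX : ClassX4M W p) (hX₁ : ClassX4Gord W₁ p) (he₁ : semistabilityIndex W₁ p = 2)
    (hsurj₁ : Surj W₁ p) {r₁ : ℕ} (hr₁ : r₁ ≤ W₁.mordellWeilRank) (hT : TorsionIso W W₁ p)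
    (S₀ : Finset (HeightOneSpectrum (𝓞 ℚ))) (hS₀ : ∀ w ∈ S₀, ((p : ℕ) : 𝓞 ℚ) ∉ w.asIdeal)
    (hS : ∀ w : HeightOneSpectrum (𝓞 ℚ), w ∉ S₀ → ((p : ℕ) : 𝓞 ℚ) ∉ w.asIdeal →
      W.HasGoodReductionAt w)
    (hS₁ : ∀ w : HeightOneSpectrum (𝓞 ℚ), w ∉ S₀ → ((p : ℕ) : 𝓞 ℚ) ∉ w.asIdeal →
      W₁.HasGoodReductionAt w)
    {b : ℕ} (hb : (b : ℤ) ≤ r₁ + ∑ w ∈ S₀, ((delta W₁ p w : ℤ) - (delta W p w : ℤ))) :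
    BudgetLeLambdaAt p W b :=
  hX.budgetLeLambdaAt_of_gv_of_gordPartner_of_congr hGV hGrK hT40 hT41 hX₁ he₁ hT S₀ hS₀ hS hS₁
    (fun hκ hγ hγ' D₁ _ ↦
      hX₁.isTorsion_and_le_lambdaInvariant_of_katoHalf hK hmodD he₁ hsurj₁ hr₁ hκ hγ hγ' D₁) hb

/-- **X3♯(M) row, X3♯(M) partner of rank `≥ r₁` — NO partner certificate, NO schema hypothesis:**
`BudgetLeLambdaAt p W b` for every `b ≤ r₁ + Σ_{w∈Σ₀} (δ(E₁,w) − δ(E,w))` from `hGV`, `hW16`, `hmodD`,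
A40/A41, a `TorsionIso` certificate, `Σ₀`, ONE census bit `p ∤ #E(ℚ)_tors`, and `r₁ ≤ rank E₁(ℚ)`
(FILE 1 + §1) — modulo the named facts, every per-pair input is a certificate or a rank.
PER PAIR; X3♯(M) stays CONSTRUCTION-SHAPED; nothing booked.
[cite: GreenbergVatsal2000, §2 Prop. (2.8) with Remark (2.9), Cor. (2.3), Prop. (2.4), pp. 26–27 (arXiv:math/9906215)]
[cite: Wuthrich2014, Thm. 16 (p. 397)] [cite: GreenbergLNM1716, Prop. 4.14, §3 Lemma 3.1]
[cite: SilvermanATAEC1994, Ch. V Thm. 5.3, Cor. 5.4] -/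
theorem ClassX3M.budgetLeLambdaAt_of_gv_of_multPartner_of_rank
    (hGV : muLambdaAlg_transfer_of_torsionIso_potOrd_of_not_dvd_torsionOrder)
    (hW16 : Wuthrich2014.thm16_halfEigenCharIdeal_dvd_cyclotomicPrime)
    (hmodD : nonempty_modularParametrizationData)
    (hT40 : Silverman1994_thmV53_tateUniformisation.{0})
    (hT41 : Silverman1994_thmV53_corV54_tateUniformisation.{0})
    (hX : ClassX3M W p) (hX₁ : ClassX3M W₁ p) {r₁ : ℕ} (hr₁ : r₁ ≤ W₁.mordellWeilRank)
    (htors : ¬ p ∣ W.torsionOrder) (hT : TorsionIso W W₁ p)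
    (S₀ : Finset (HeightOneSpectrum (𝓞 ℚ))) (hS₀ : ∀ w ∈ S₀, ((p : ℕ) : 𝓞 ℚ) ∉ w.asIdeal)
    (hS : ∀ w : HeightOneSpectrum (𝓞 ℚ), w ∉ S₀ → ((p : ℕ) : 𝓞 ℚ) ∉ w.asIdeal →
      W.HasGoodReductionAt w)
    (hS₁ : ∀ w : HeightOneSpectrum (𝓞 ℚ), w ∉ S₀ → ((p : ℕ) : 𝓞 ℚ) ∉ w.asIdeal →
      W₁.HasGoodReductionAt w)
    {b : ℕ} (hb : (b : ℤ) ≤ r₁ + ∑ w ∈ S₀, ((delta W₁ p w : ℤ) - (delta W p w : ℤ))) :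
    BudgetLeLambdaAt p W b :=
  hX.budgetLeLambdaAt_of_gv_of_multPartner_of_congr hGV hT40 hT41 hX₁ htors hT S₀ hS₀ hS hS₁
    (fun hκ hγ hγ' D₁ _ ↦
      hX₁.isTorsion_and_le_lambdaInvariant_of_wuthrichHalf hW16 hmodD hr₁ hκ hγ hγ' D₁) hb

/-- **X3♯(M) row, X3♯(G-ord) ∩ `I₀*` partner of rank `≥ r₁` — NO partner certificate, NO schema
hypothesis**, mod A40/A41 | `hGrK` (FILE 1 + §1). PER PAIR; nothing booked.
[cite: GreenbergVatsal2000, §2 Prop. (2.8) with Remark (2.9), Cor. (2.3), Prop. (2.4), pp. 26–27 (arXiv:math/9906215)]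
[cite: Wuthrich2014, Thm. 16 (p. 397)] [cite: GreenbergLNM1716, Prop. 4.14, §2 Props. 2.2, 2.4, §3 Lemma 3.1] -/
theorem ClassX3M.budgetLeLambdaAt_of_gv_of_gordPartner_of_rank
    (hGV : muLambdaAlg_transfer_of_torsionIso_potOrd_of_not_dvd_torsionOrder)
    (hGrK : imKummer_ge_strictCondition_goodOrdinary)
    (hW16 : Wuthrich2014.thm16_halfEigenCharIdeal_dvd_cyclotomicPrime)
    (hmodD : nonempty_modularParametrizationData)
    (hT40 : Silverman1994_thmV53_tateUniformisation.{0})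
    (hT41 : Silverman1994_thmV53_corV54_tateUniformisation.{0})
    (hX : ClassX3M W p) (hX₁ : ClassX3Gord W₁ p) (he₁ : semistabilityIndex W₁ p = 2) {r₁ : ℕ}
    (hr₁ : r₁ ≤ W₁.mordellWeilRank) (htors : ¬ p ∣ W.torsionOrder) (hT : TorsionIso W W₁ p)
    (S₀ : Finset (HeightOneSpectrum (𝓞 ℚ))) (hS₀ : ∀ w ∈ S₀, ((p : ℕ) : 𝓞 ℚ) ∉ w.asIdeal)
    (hS : ∀ w : HeightOneSpectrum (𝓞 ℚ), w ∉ S₀ → ((p : ℕ) : 𝓞 ℚ) ∉ w.asIdeal →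
      W.HasGoodReductionAt w)
    (hS₁ : ∀ w : HeightOneSpectrum (𝓞 ℚ), w ∉ S₀ → ((p : ℕ) : 𝓞 ℚ) ∉ w.asIdeal →
      W₁.HasGoodReductionAt w)
    {b : ℕ} (hb : (b : ℤ) ≤ r₁ + ∑ w ∈ S₀, ((delta W₁ p w : ℤ) - (delta W p w : ℤ))) :
    BudgetLeLambdaAt p W b :=
  hX.budgetLeLambdaAt_of_gv_of_gordPartner_of_congr hGV hGrK hT40 hT41 hX₁ he₁ htors hT S₀ hS₀ hS
    hS₁
    (fun hκ hγ hγ' D₁ _ ↦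
      hX₁.isTorsion_and_le_lambdaInvariant_of_wuthrichHalf hW16 hmodD hX.p_ne_two he₁ hr₁ hκ hγ hγ'
        D₁) hb

end Composed

end Summit.BirchSwinnertonDyer.Rank1Residual.AdditivePotMult

end
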